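import Summits.ABC.IUTFork.Cor312PinnedIndTrivialSharp
import Summits.ABC.IUTFork.Cor312PilotKummerSplitWitness
import Summits.ABC.IUTFork.Cor312PilotKummerNaturalAct
import Summits.ABC.IUTFork.Cor312UnitPositive
import Summits.ABC.IUTFork.Repair.CandMochizuki5
import HarnessLib

/-!
# [IUTchIII] Cor. 3.12 — the (Ind)-TRIVIALITY COLUMN completed over abc-iut-rp-plan's PROFILE v0.4 beds of record (P♮⁺, unit-P♭, MID)

Proof-only junction file (D-0012; NO definition, NO `Prop` fact) of the abc-iut cell (WAVE-5 prover abc-iut-w5-d068, gen 4), third part of this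
seat's (Ind)-triviality ledger `Cor312PinnedIndTrivial` (p429312 / p429693 / p429946) · `Cor312PinnedIndTrivialSharp` (p430151 … p433890, v6 p437181),
written for the IUT REPAIR branch (abc-iut-rp-plan REPAIR-SPEC §3 «T-b PROFILE v0.4 — NON-(Ind)-TRIVIAL POINTS», §J checkpoint 3). TAKES NO SIDE on
[IUTchIII] Cor. 3.12 or on any author; toy carriers; instantiated ≠ endorsed.

(Ind)-TRIVIALITY (inline hypothesis, never asserted): the group ⟨(Ind1) ∪ (Ind2)⟩ fixes the (Ind3)-enlarged Θ-region `thetaRegion3` setwise. On such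
settings the residual `S = PilotKummerIndRelated` READS the bare identification `ρ qK = ρ Ψ_n` and coincides with Team R's `IdentifiedReading`
(`IndTrivial.residual_iff_regions_eq_pinned`, `identifiedReading_iff_indTrivial_and_residual`); on the others it does not.

RESULTS (ns `Summit.ABC.IUTFork.Cor312Vol.IndTrivial`) — the three beds of abc-iut-rp-h2's PROFILE v0.4 bed list (P♮ · P♮₁ · P♮⁺ · U · unit-P♭ ·
FLIP · MID · FAT · SCAL) that had no cell:
* **`actSetting_not_indTrivial`** — abc-iut-rp-d2's P♮⁺ `NaturalActWitness.actSetting` (`Cor312PilotKummerNaturalAct`: abc-iut-w5-d230's P♮ with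
  the honest multiplicative action (i)(b), everything else unchanged): the SAME half-shell Θ-region `halfPos`, moved by the same (Ind2)-sign
  `flipFamily` ⇒ NON-(Ind)-trivial — the action field is not read by (Ind)-triviality;
* **`indTrivial_uWithQDatum` / `indTrivial_uLinkId`** — abc-iut-w5-d147's unit `withQDatum` family and the unit-P♭ `UnitWitness.uLinkId`
  (`Cor312UnitPositive`): ball glue over abc-iut-w4-d101's unit shells ⇒ (Ind)-TRIVIAL, one `exact` of `indTrivial_of_ball_regions_unit`;
* **`indTrivial_midSetting`** — abc-iut-rp-m1's MID-inflation bed `Repair.CandMochizuki5.midSetting` (CM `pinnedSetting p` with ONLY the hull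
  frame replaced by the mid `p`-adic frame): its Θ-regions are CM's balls `B_{j²}` definitionally ⇒ (Ind)-TRIVIAL — the frame is invisible to
  (Ind)-triviality, exactly as for the frame flip;
* `profile_v04_indTriviality_column` — the nine cells packaged. FINAL LEDGER over the beds of record: NON-(Ind)-trivial = P♮ (sign), P♮⁺
  (sign, honest action), P♮₁ ((Ind1) capsule permutation — print's own mover), COSET (units; abc-iut-w4-d101 `UnitCoset.cSetting_not_indTrivial`),
  every ball-glued SCAL setting (`not_indTrivial_of_ball_regions_scaling`); (Ind)-TRIVIAL = CM, FLIP, LS, P♭, P♯, `withQDatum`, U,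
  unit-`withQDatum` / unit-P♭, MID, FAT, height.
Consumed BY NAME; standard axioms; typed ≠ proved. [claim: Mochizuki2012, status: disputed] [cite: ScholzeStix2018, §2.2 pp. 9–10]
-/

noncomputable section

open Set

namespace Summit.ABC.IUTFork.Cor312Vol.IndTrivial

open Thm311 Cor312 Cor312.Checks Cor312.IdentifiedNonVacuity Cor312Vol NaiveWitness NaturalWitness Literature.IUT.LogThetaLattice

section ProfileBeds

variable (p : ℕ) [hp : Fact p.Prime]

/-- **P♮⁺ is NOT (Ind)-trivial.** abc-iut-rp-d2's `NaturalActWitness.actSetting` (`Cor312PilotKummerNaturalAct`: abc-iut-w5-d230's P♮ with the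
honest multiplicative action (i)(b), everything else unchanged) has the SAME (Ind3)-enlarged Θ-region `halfPos` at a label of `𝔽_l^⋇`
(`act_regions_of_ne_zero`) and the same (Ind2)-sign `flipFamily ∈ indGroup` (`flipFamily_mem_indGroup_act`) moving it onto `halfNeg ∌ lpt 1`:
the action field is not read by (Ind)-triviality. [folklore] -/
theorem actSetting_not_indTrivial :
    ¬ ∀ Φ ∈ Setting.indGroup NaturalActWitness.actSituation, ∀ (j : toyIndex.Label) (vQ : toyIndex.VQ),
        Φ j vQ '' NaturalActWitness.actSetting.thetaRegion3 j vQ = NaturalActWitness.actSetting.thetaRegion3 j vQ := fun hfix => by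
  have hj : (Setting.labelSucc (T := toyIndex) ⟨0, by decide⟩) ≠ 0 := Setting.labelSucc_ne_zero _
  have h := hfix flipFamily NaturalActWitness.flipFamily_mem_indGroup_act (Setting.labelSucc ⟨0, by decide⟩) ()
  rw [(NaturalActWitness.act_regions_of_ne_zero hj ()).1, image_halfPos_flipFamily] at h
  have hm := lpt_one_mem (Setting.labelSucc (T := toyIndex) ⟨0, by decide⟩) ()
  exact hm.2.2.1 (h.symm ▸ hm.1)

/-- **abc-iut-w5-d147's unit `withQDatum` family is (Ind)-trivial** (`Cor312UnitPositive`: abc-iut-w4-d101's unit setting with the q-glue replaced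
by the orbit region of a ball-valued Kummer datum; the Θ-regions stay `B_{j²}`, `uWithQDatum_thetaRegion3`): one `exact` of the unit-shell ball
criterion `indTrivial_of_ball_regions_unit`. [folklore] -/
theorem indTrivial_uWithQDatum (qK : ∀ v : toyIndex.V, v ∈ toyIndex.Vbad → Set ((UnitWitness.unitShells p).StarPacket v))
    (hqK : ∀ (j : toyIndex.Label) (vQ : toyIndex.VQ), ∃ k : ℤ, UnitWitness.uBall p j vQ k = PinnedWitness.orbitRegion p qK j vQ) :
    ∀ Φ ∈ Setting.indGroup (UnitWitness.uFull p).toLatticeSituation.toSituation, ∀ (j : toyIndex.Label) (vQ : toyIndex.VQ),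
      Φ j vQ '' (UnitWitness.uWithQDatum p qK hqK).thetaRegion3 j vQ = (UnitWitness.uWithQDatum p qK hqK).thetaRegion3 j vQ :=
  indTrivial_of_ball_regions_unit p (UnitWitness.uWithQDatum p qK hqK) fun j vQ =>
    ⟨_, UnitWitness.uWithQDatum_thetaRegion3 p qK hqK j vQ⟩

/-- **The unit-P♭ `UnitWitness.uLinkId p` (abc-iut-w5-d147: q-datum := the line-`0` splitting monoid; S attained, Statement with equality) is
(Ind)-trivial** — like the sign-shell P♭, it evaluates a candidate through the bare identification. [folklore] -/
theorem indTrivial_uLinkId :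
    ∀ Φ ∈ Setting.indGroup (UnitWitness.uFull p).toLatticeSituation.toSituation, ∀ (j : toyIndex.Label) (vQ : toyIndex.VQ),
      Φ j vQ '' (UnitWitness.uLinkId p).thetaRegion3 j vQ = (UnitWitness.uLinkId p).thetaRegion3 j vQ :=
  indTrivial_uWithQDatum p _ _

omit hp in
/-- **abc-iut-rp-m1's MID-inflation bed `Repair.CandMochizuki5.midSetting p` is (Ind)-trivial**: it is CM (`pinnedSetting p`) with ONLY the hull
frame changed (the mid `p`-adic frame: inflation present but below the budget), so its (Ind3)-enlarged Θ-regions are CM's balls `B_{j²}`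
(`PinnedWitness.pinnedSetting_thetaRegion3`, definitionally) and the sign group fixes them — the frame is invisible to (Ind)-triviality, exactly as
for the frame flip. [folklore] -/
theorem indTrivial_midSetting :
    ∀ Φ ∈ Setting.indGroup (naiveFull p).toLatticeSituation.toSituation, ∀ (j : toyIndex.Label) (vQ : toyIndex.VQ),
      Φ j vQ '' (Repair.CandMochizuki5.midSetting p).thetaRegion3 j vQ = (Repair.CandMochizuki5.midSetting p).thetaRegion3 j vQ :=
  indTrivial_of_ball_regions_naive p (Repair.CandMochizuki5.midSetting p) fun j vQ =>
    ⟨jsq j, show (PinnedWitness.pinnedSetting p).thetaRegion3 j vQ = _ from PinnedWitness.pinnedSetting_thetaRegion3 p j vQ⟩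

omit hp in
/-- **THE (Ind)-TRIVIALITY COLUMN OVER THE PROFILE v0.4 BEDS OF RECORD, packaged** (abc-iut-rp-plan REPAIR-SPEC §3 / §J; bed list of abc-iut-rp-h2's
RP-H02 table): NON-(Ind)-trivial — P♮ (sign), P♮⁺ (sign, honest action), P♮₁ ((Ind1) capsule permutation); (Ind)-TRIVIAL — U, unit-P♭, FLIP, MID,
FAT (every `d`), and CM for reference; SCAL (ball glue ⇒ non-trivial) is `not_indTrivial_of_ball_regions_scaling` (Sharp v3 §3), COSET (non-trivial)
is abc-iut-w4-d101's `UnitCoset.cSetting_not_indTrivial`. On the (Ind)-trivial beds S reads «`ρ qK = ρ Ψ_n`» and coincides with Team R's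
`IdentifiedReading`; on the non-trivial ones it does not (P♮: `residual_and_not_identified_at_natural`; P♮₁: `indTrivial_hypothesis_sharp_split`).
[folklore] -/
theorem profile_v04_indTriviality_column (p : ℕ) [Fact p.Prime] :
    (¬ ∀ Φ ∈ Setting.indGroup natSituation, ∀ (j : toyIndex.Label) (vQ : toyIndex.VQ),
        Φ j vQ '' natSetting.thetaRegion3 j vQ = natSetting.thetaRegion3 j vQ) ∧
      (¬ ∀ Φ ∈ Setting.indGroup NaturalActWitness.actSituation, ∀ (j : toyIndex.Label) (vQ : toyIndex.VQ),
          Φ j vQ '' NaturalActWitness.actSetting.thetaRegion3 j vQ = NaturalActWitness.actSetting.thetaRegion3 j vQ) ∧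
      (¬ ∀ Φ ∈ Setting.indGroup SplitWitness.splitSituation, ∀ (j : SplitWitness.splitIndex.Label) (vQ : SplitWitness.splitIndex.VQ),
          Φ j vQ '' SplitWitness.splitSetting.thetaRegion3 j vQ = SplitWitness.splitSetting.thetaRegion3 j vQ) ∧
      (∀ Φ ∈ Setting.indGroup (UnitWitness.uFull p).toLatticeSituation.toSituation, ∀ (j : toyIndex.Label) (vQ : toyIndex.VQ),
          Φ j vQ '' (UnitWitness.uSetting p).thetaRegion3 j vQ = (UnitWitness.uSetting p).thetaRegion3 j vQ) ∧
      (∀ Φ ∈ Setting.indGroup (UnitWitness.uFull p).toLatticeSituation.toSituation, ∀ (j : toyIndex.Label) (vQ : toyIndex.VQ),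
          Φ j vQ '' (UnitWitness.uLinkId p).thetaRegion3 j vQ = (UnitWitness.uLinkId p).thetaRegion3 j vQ) ∧
      (∀ Φ ∈ Setting.indGroup (naiveFull p).toLatticeSituation.toSituation, ∀ (j : toyIndex.Label) (vQ : toyIndex.VQ),
          Φ j vQ '' (PinnedHonest.flipSetting p).thetaRegion3 j vQ = (PinnedHonest.flipSetting p).thetaRegion3 j vQ) ∧
      (∀ Φ ∈ Setting.indGroup (naiveFull p).toLatticeSituation.toSituation, ∀ (j : toyIndex.Label) (vQ : toyIndex.VQ),
          Φ j vQ '' (Repair.CandMochizuki5.midSetting p).thetaRegion3 j vQ = (Repair.CandMochizuki5.midSetting p).thetaRegion3 j vQ) ∧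
      (∀ (d : ℕ), ∀ Φ ∈ Setting.indGroup (Repair.CandInternal2Fat.fatSituation p d), ∀ (j : toyIndex.Label) (vQ : toyIndex.VQ),
          Φ j vQ '' (Repair.CandInternal2Fat.fatPinned p d).thetaRegion3 j vQ = (Repair.CandInternal2Fat.fatPinned p d).thetaRegion3 j vQ) ∧
      (∀ Φ ∈ Setting.indGroup (naiveFull p).toLatticeSituation.toSituation, ∀ (j : toyIndex.Label) (vQ : toyIndex.VQ),
          Φ j vQ '' (PinnedWitness.pinnedSetting p).thetaRegion3 j vQ = (PinnedWitness.pinnedSetting p).thetaRegion3 j vQ) :=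
  ⟨natSetting_not_indTrivial, actSetting_not_indTrivial, splitSetting_not_indTrivial, indTrivial_uSetting p, indTrivial_uLinkId p,
    indTrivial_flipSetting p, indTrivial_midSetting p, indTrivial_fatPinned p, indTrivial_pinnedSetting p⟩

end ProfileBeds

end Summit.ABC.IUTFork.Cor312Vol.IndTrivial

end
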